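import Literature.NumberTheory.LFunctions.KloostermanPrimePowerTools
import HarnessLib

/-!
# Route `PrimeLevelFamEdge`, crux K_A `MomentsBeyondDiagonal` (stmt-Parity-20007), line «petersson_layers» v4:
# the GCD EXTRACTION `φ(c)·S(gm, gn; gc) = φ(gc)·S(m, n; c)` for Kloosterman sums (any modulus)

Pascadi's Theorem 7.1 (the print band of `stub_farP`; Literature fact `pascadi2025_theorem71`) bounds bilinear
Kloosterman forms restricted to `(m, n, c) = 1`.  A Petersson layer `K_r` (modulus `c = q r`) regrouped as a
bilinear form contains ALL pairs; the terms with `(m, n, c) = g > 1` are reduced to the coprime case at the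
smaller modulus `c/g` by the classical scaling identity (Pascadi, §1.1 after (1.2): «since
`S(gm, gn; gc) = (φ(gc)/φ(c)) S(m, n; c)`, one can separately consider each value of `(m, n, c)`»), proved here
for the tree's `kloostermanSum`, every modulus `c ≥ 1` and every `g ≥ 1`, in the division-free form

  `φ(c) · S(gm, gn; gc) = φ(gc) · S(m, n; c)`      (`totient_mul_kloostermanSum_scale`).

Proof: `e((gm·w + gn·w̄)/(gc)) = e((m·π(w) + n·π(w)̄)/c)` for the reduction `π : (ℤ/gc)ˣ → (ℤ/c)ˣ`
(Mathlib `ZMod.unitsMap`, surjective: `ZMod.unitsMap_surjective`), whose fibres all have the same size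
(`MonoidHom.card_fiber_eq_of_mem_range`), namely `φ(gc)/φ(c)`.
Companion of `…LayersKloostermanProduct` (`S(a,b;c) = S(1,ab;c)` under `((a,b),c) = 1`) and `…LayersFourierBound`.
Proof only (def-free helper toward `stub_farP` / `stub_band`); no layer is bounded here; K_A NOT proved; nothing
about Landau–Siegel zeros.
-/

noncomputable section

open Finset
open Literature.NumberTheory.LFunctions

namespace Summit.Parity.GeneralizedHardyLittlewood.Theorems.MomentsBeyondDiagonal.Layers

/-! ## §1. Sums over the unit group through the reduction map -/

/-- **Uniform fibres**: for `c ∣ C` (`C ≥ 1`) and any `F` on the units mod `c`,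
`φ(c) · Σ_{w ∈ (ℤ/C)ˣ} F(π w) = φ(C) · Σ_{u ∈ (ℤ/c)ˣ} F(u)`, `π` the reduction of units (surjective, all
fibres of equal size). [folklore] -/
theorem totient_mul_sum_units_comp_unitsMap {C c : ℕ} [NeZero C] [NeZero c] (h : c ∣ C)
    (F : (ZMod c)ˣ → ℂ) :
    (c.totient : ℂ) * ∑ w : (ZMod C)ˣ, F (ZMod.unitsMap h w) =
      (C.totient : ℂ) * ∑ u : (ZMod c)ˣ, F u := by
  classical
  set π : (ZMod C)ˣ →* (ZMod c)ˣ := ZMod.unitsMap h with hπ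
  have hsurj : Function.Surjective π := ZMod.unitsMap_surjective h
  -- the common fibre size
  set k : ℕ := #{w : (ZMod C)ˣ | π w = 1} with hk
  have hfib : ∀ u : (ZMod c)ˣ, #{w : (ZMod C)ˣ | π w = u} = k := fun u ↦
    MonoidHom.card_fiber_eq_of_mem_range π (hsurj u) (hsurj 1)
  -- sum fibrewise
  have hsum : ∑ w : (ZMod C)ˣ, F (π w) = (k : ℂ) * ∑ u : (ZMod c)ˣ, F u := by
    rw [← Finset.sum_fiberwise (Finset.univ : Finset (ZMod C)ˣ) π (fun w ↦ F (π w)), Finset.mul_sum]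
    refine Finset.sum_congr rfl fun u _ ↦ ?_
    rw [Finset.sum_congr rfl fun w hw ↦ by rw [(Finset.mem_filter.mp hw).2], Finset.sum_const, hfib u,
      nsmul_eq_mul]
  -- count: |(ℤ/C)ˣ| = k · |(ℤ/c)ˣ|
  have hcard : Fintype.card (ZMod C)ˣ = k * Fintype.card (ZMod c)ˣ := by
    rw [← Finset.card_univ, Finset.card_eq_sum_card_fiberwise (f := π) (t := Finset.univ) (fun _ _ ↦ mem_univ _)]
    simp_rw [hfib]
    rw [Finset.sum_const, Finset.card_univ, smul_eq_mul, mul_comm]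
  rw [ZMod.card_units_eq_totient, ZMod.card_units_eq_totient] at hcard
  rw [hsum, ← mul_assoc, hcard]
  push_cast
  ring

/-! ## §2. The scaling identity -/

/-- `e(g·K/(g·c)) = e(K/c)` for natural `K` (additive characters of `ℤ/gcℤ` on the multiples of `g`). [folklore] -/
theorem stdAddChar_mul_natCast {g c : ℕ} [NeZero c] [NeZero (g * c)] (hg : 0 < g) (K : ℕ) :
    (ZMod.stdAddChar ((g * K : ℕ) : ZMod (g * c)) : ℂ) = ZMod.stdAddChar ((K : ℕ) : ZMod c) := by
  rw [stdAddChar_natCast, stdAddChar_natCast]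
  congr 1
  have hg0 : (g : ℂ) ≠ 0 := Nat.cast_ne_zero.mpr hg.ne'
  have hc0 : (c : ℂ) ≠ 0 := Nat.cast_ne_zero.mpr (NeZero.ne c)
  push_cast
  field_simp

/-- The summand of `S(gm, gn; gc)` at a unit `w` is the summand of `S(m, n; c)` at its reduction `π(w)`. [folklore] -/
theorem stdAddChar_scale_term {g c : ℕ} [NeZero c] [NeZero (g * c)] (hg : 0 < g) (m n : ℕ) (w : (ZMod (g * c))ˣ) :
    (ZMod.stdAddChar (((g * m : ℕ) : ZMod (g * c)) * (w : ZMod (g * c)) +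
        ((g * n : ℕ) : ZMod (g * c)) * ((w⁻¹ : (ZMod (g * c))ˣ) : ZMod (g * c))) : ℂ) =
      ZMod.stdAddChar ((m : ZMod c) * (ZMod.unitsMap (dvd_mul_left c g) w : ZMod c) +
        (n : ZMod c) * (((ZMod.unitsMap (dvd_mul_left c g) w)⁻¹ : (ZMod c)ˣ) : ZMod c)) := by
  set a : ℕ := (w : ZMod (g * c)).val with ha
  set b : ℕ := ((w⁻¹ : (ZMod (g * c))ˣ) : ZMod (g * c)).val with hb
  have haw : ((a : ℕ) : ZMod (g * c)) = (w : ZMod (g * c)) := ZMod.natCast_zmod_val _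
  have hbw : ((b : ℕ) : ZMod (g * c)) = ((w⁻¹ : (ZMod (g * c))ˣ) : ZMod (g * c)) := ZMod.natCast_zmod_val _
  -- left-hand side: the argument is `g · (m a + n b)` as a natural number
  have hL : ((g * m : ℕ) : ZMod (g * c)) * (w : ZMod (g * c)) +
      ((g * n : ℕ) : ZMod (g * c)) * ((w⁻¹ : (ZMod (g * c))ˣ) : ZMod (g * c)) =
        ((g * (m * a + n * b) : ℕ) : ZMod (g * c)) := by
    rw [← haw, ← hbw]
    push_cast
    ring
  -- right-hand side: the reductions are the casts of `a`, `b`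
  have hπa : (ZMod.unitsMap (dvd_mul_left c g) w : ZMod c) = ((a : ℕ) : ZMod c) := by
    rw [ZMod.unitsMap_val, ZMod.cast_eq_val]
  have hπb : ((((ZMod.unitsMap (dvd_mul_left c g) w)⁻¹ : (ZMod c)ˣ)) : ZMod c) =
      (((b : ℕ) : ZMod c)) := by
    rw [← map_inv, ZMod.unitsMap_val, ZMod.cast_eq_val]
  have hR : (m : ZMod c) * (ZMod.unitsMap (dvd_mul_left c g) w : ZMod c) +
      (n : ZMod c) * (((ZMod.unitsMap (dvd_mul_left c g) w)⁻¹ : (ZMod c)ˣ) : ZMod c) =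
        ((m * a + n * b : ℕ) : ZMod c) := by
    rw [hπa, hπb]
    push_cast
    ring
  rw [hL, hR, stdAddChar_mul_natCast hg]

/-- **GCD extraction for Kloosterman sums (any modulus `c ≥ 1`, any `g ≥ 1`):**
`φ(c) · S(gm, gn; gc) = φ(gc) · S(m, n; c)` — i.e. `S(gm, gn; gc) = (φ(gc)/φ(c)) S(m, n; c)`, the identity by which a
bilinear Kloosterman form is reduced to its coprime part `(m, n, c) = 1` modulus by modulus (Pascadi 2025, §1.1).
[cite: Pascadi2025, §1.1 (display after (1.2))] -/
theorem totient_mul_kloostermanSum_scale {g c : ℕ} [NeZero c] [NeZero (g * c)] (hg : 0 < g) (m n : ℕ) :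
    (c.totient : ℂ) * kloostermanSum (g * c) ((g * m : ℕ) : ZMod (g * c)) ((g * n : ℕ) : ZMod (g * c)) =
      ((g * c).totient : ℂ) * kloostermanSum c (m : ZMod c) (n : ZMod c) := by
  rw [kloostermanSum_eq_sum_units, kloostermanSum_eq_sum_units]
  simp_rw [stdAddChar_scale_term hg m n]
  exact totient_mul_sum_units_comp_unitsMap (dvd_mul_left c g)
    (fun u : (ZMod c)ˣ ↦ (ZMod.stdAddChar ((m : ZMod c) * (u : ZMod c) + (n : ZMod c) * ((u⁻¹ : (ZMod c)ˣ) : ZMod c)) : ℂ))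

/-- The same identity with the modulus written `c' = g·c` given as a hypothesis (the form met when `g = (m', n', c')`
is extracted from a term of a layer: `c' = q r`, `g ∣ r`). [cite: Pascadi2025, §1.1 (display after (1.2))] -/
theorem totient_mul_kloostermanSum_of_eq_mul {g c c' : ℕ} [NeZero c] [NeZero c'] (hc' : c' = g * c) (m n : ℕ) :
    (c.totient : ℂ) * kloostermanSum c' ((g * m : ℕ) : ZMod c') ((g * n : ℕ) : ZMod c') =
      (c'.totient : ℂ) * kloostermanSum c (m : ZMod c) (n : ZMod c) := by
  subst hc'
  have hg : 0 < g := Nat.pos_of_ne_zero fun h ↦ NeZero.ne (g * c) (by rw [h, zero_mul])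
  exact totient_mul_kloostermanSum_scale hg m n

end Summit.Parity.GeneralizedHardyLittlewood.Theorems.MomentsBeyondDiagonal.Layers

end
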